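import Mathlib
import HarnessLib
import Literature.MathematicalPhysics.StatisticalMechanics.TorusEllipticDeterminant
import Literature.MathematicalPhysics.StatisticalMechanics.WeightDataOfFRD
import Summits.HubbardSuperconductivity.HubbardSuperconductivity.Theorems.ComplexGFFStiffnessHypALocalTwoPointLogCalculus

/-!
# Crux `HypALocalTwoPoint`, line `gnv` — the Gaussian normalisation `log κ_{𝟙,𝟙+q}` is Lipschitz in
# the tuning parameter `q` with Lipschitz first differences, with constants `|Λ|`, `2|Λ|`
# (volume-uniform PER SITE)

Route `route-HubbardSuperconductivity-ComplexGFFStiffness`, crux item stmt-HubbardSuperconductivity-19155,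
registered stub `stub_twoPointGivenZ`, census entry (F2) of `TWOPOINT-PLAN-cgffstiff2-g0.md` §3 for the
research statement `FreeEnergyBounds`: the free energy is `f(𝒦) = log κ_{𝟙,𝟙+q(ℋ⋆(𝒦))} + λ(ℋ⋆(𝒦))|Λ| +
Log I(𝒦)` ([ABKM19] (4.7)–(4.12) with the tuned `ℋ⋆` of Lemma 12.6); the Gaussian factor
`κ_{𝟙,𝟙+q} = Z^{(q)}/Z^{(0)}` (`GradientRG.formChangeConst 1 (1+q)`) is, by
`Literature/…/TorusEllipticDeterminant` (`log_formChangeConst_eq`), the mode sum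
`log κ_{𝟙,𝟙+q} = −½ Σ_{κ≠0} log(1 + symbR q κ / |q(κ)|²)`, each of the `|Λ| − 1` terms depending on
`q` only through the ratio `symbR q κ/|q(κ)|² ∈ [−s, s]` for a symmetric `q` with `|z·qz| ≤ s|z|²`.
Hence (this file):

* `posDef_ellMat_add_constMat` — the regularised precisions `∇*A∇ + c𝟙𝟙ᵀ` are positive definite for
  elliptic `A`, `c > 0` (positive semidefinite with positive determinant);
* `log_formChangeConst_one_add_eq` — the mode-sum formula above;
* **`abs_log_formChangeConst_sub_le`** — `|log κ_{𝟙,𝟙+q₁} − log κ_{𝟙,𝟙+q₂}| ≤ |Λ|·t` when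
  `|z·(q₁−q₂)z| ≤ t|z|²` and `q₁, q₂` have form bound `½`;
* **`abs_secondDiff_log_formChangeConst_le`** — over a parallelogram `q, q+a, q+b, q+a+b` of such
  parameters, `|Σ± log κ| ≤ 2|Λ|·t_a·t_b`.

These are the `N`-uniform first/second DIFFERENCE bounds of the Gaussian part of the free energy (the
factor `|Λ|` is the extensivity required by `FreeEnergyBounds`).  All proved, no `sorry`.

## References
* S. Adams, S. Buchholz, R. Kotecký, S. Müller, arXiv:1910.13564, Ch. 4.2 (4.7), Theorem 2.2
  [AdamsBuchholzKoteckyMuller2019].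
* S. Buchholz, J. Funct. Anal. 275 (2018), §2 (2.18) [Buchholz2016].
-/

noncomputable section

-- `Summit.<Summit>.<Problem>`: single-conjunct summit, the duplicate component is mandated (D-0017).
set_option linter.dupNamespace false

namespace Summit.HubbardSuperconductivity.HubbardSuperconductivity.Theorems.ComplexGFF

open scoped BigOperators Matrix
open Finset Matrix
open Literature.MathematicalPhysics.StatisticalMechanics.GradientRG
open Literature.MathematicalPhysics.StatisticalMechanics.GradientFRD (qmode symbR qnormSq qnormSq_pos IsElliptic
  symbR_pos symbR_add_smul)

variable {d M : ℕ} [NeZero M]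

/-! ## Symmetric directions with a quadratic-form bound -/

/-- `symbR` is additive in the coefficient matrix. -/
theorem symbR_add (A B : Matrix (Fin d) (Fin d) ℝ) (κ : Fin d → ZMod M) :
    symbR (A + B) κ = symbR A κ + symbR B κ := by
  have h := symbR_add_smul A B 1 κ
  rwa [one_smul, one_mul] at h

/-- `symbR` respects subtraction of coefficient matrices. -/
theorem symbR_sub (A B : Matrix (Fin d) (Fin d) ℝ) (κ : Fin d → ZMod M) :
    symbR (A - B) κ = symbR A κ - symbR B κ := by
  have h := symbR_add (A - B) B κ
  rw [sub_add_cancel] at h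
  linarith

/-- **Quadratic-form bound ⇒ symbol bound**: if `|z·qz| ≤ s|z|²` for all real `z`, then
`|symbR q κ| ≤ s·|q(κ)|²` (apply the bound to the real and imaginary parts of the mode vector). -/
theorem abs_symbR_le_of_form_le {q : Matrix (Fin d) (Fin d) ℝ} {s : ℝ}
    (hs : ∀ z : Fin d → ℝ, |∑ i, ∑ j, z i * q i j * z j| ≤ s * ∑ i, (z i) ^ 2) (κ : Fin d → ZMod M) :
    |symbR q κ| ≤ s * qnormSq κ := by
  have hre := hs fun j => (qmode κ j).re
  have him := hs fun j => (qmode κ j).im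
  have hsplit : symbR q κ = (∑ i, ∑ j, (qmode κ i).re * q i j * (qmode κ j).re) +
      ∑ i, ∑ j, (qmode κ i).im * q i j * (qmode κ j).im := by
    unfold symbR
    rw [← Finset.sum_add_distrib]
    refine sum_congr rfl fun i _ => ?_
    rw [← Finset.sum_add_distrib]
    refine sum_congr rfl fun j _ => ?_
    ring
  have hnorm : qnormSq κ = ∑ j, (qmode κ j).re ^ 2 + ∑ j, (qmode κ j).im ^ 2 := by
    unfold qnormSq
    rw [← Finset.sum_add_distrib]
    refine sum_congr rfl fun j _ => ?_
    rw [← Complex.normSq_eq_norm_sq, Complex.normSq_apply]; ring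
  rw [hsplit, hnorm, mul_add]
  exact (abs_add_le _ _).trans (add_le_add hre him)

/-- `𝟙 + q` is elliptic with constants `1 − s`, `1 + s` for a symmetric `q` with `|z·qz| ≤ s|z|²`. -/
theorem isElliptic_one_add_of_form_le {q : Matrix (Fin d) (Fin d) ℝ} {s : ℝ} (hq : q.IsSymm)
    (hs : ∀ z : Fin d → ℝ, |∑ i, ∑ j, z i * q i j * z j| ≤ s * ∑ i, (z i) ^ 2) :
    IsElliptic (1 - s) (1 + s) ((1 : Matrix (Fin d) (Fin d) ℝ) + q) := by
  refine ⟨?_, fun z => ?_⟩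
  · unfold Matrix.IsSymm at hq ⊢
    rw [Matrix.transpose_add, Matrix.transpose_one, hq]
  have hquad : ∑ i, ∑ j, z i * ((1 : Matrix (Fin d) (Fin d) ℝ) + q) i j * z j
      = ∑ i, (z i) ^ 2 + ∑ i, ∑ j, z i * q i j * z j := by
    rw [← Finset.sum_add_distrib]
    refine sum_congr rfl fun i _ => ?_
    have h1 : ∑ j, z i * (1 : Matrix (Fin d) (Fin d) ℝ) i j * z j = z i ^ 2 := by
      rw [Finset.sum_eq_single i (fun j _ hji => by rw [Matrix.one_apply_ne (Ne.symm hji), mul_zero, zero_mul])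
        (fun h => absurd (Finset.mem_univ i) h), Matrix.one_apply_eq]
      ring
    rw [← h1, ← Finset.sum_add_distrib]
    refine sum_congr rfl fun j _ => ?_
    rw [Matrix.add_apply]; ring
  have hb := abs_le.1 (hs z)
  rw [hquad]
  constructor <;> nlinarith [hb.1, hb.2]

/-! ## Positive definiteness of the regularised precisions -/

/-- **`∇*A∇ + c𝟙𝟙ᵀ` is positive definite** for elliptic `A` (`ω₀ > 0`) and `c > 0`: it is symmetric,
positive semidefinite (`⟨φ,∇*A∇φ⟩ ≥ ω₀Σ|∇φ|² ≥ 0`, `⟨φ, c𝟙𝟙ᵀφ⟩ = c(Σφ)² ≥ 0`) and has positive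
determinant (`det_ellMat_add_constMat_pos`). -/
theorem posDef_ellMat_add_constMat {ω₀ Ω₀ : ℝ} {A : Matrix (Fin d) (Fin d) ℝ} (hA : IsElliptic ω₀ Ω₀ A)
    (hω : 0 < ω₀) {c : ℝ} (hc : 0 < c) :
    (ellMat (M := M) A + constMat c).PosDef := by
  have hsymm : (ellMat (M := M) A + constMat c).IsHermitian := by
    unfold Matrix.IsHermitian
    rw [Matrix.conjTranspose_eq_transpose_of_trivial, Matrix.transpose_add, ellMat_transpose hA.1]
    congr 1
  have hnonneg : ∀ φ : (Fin d → ZMod M) → ℝ, 0 ≤ φ ⬝ᵥ (ellMat (M := M) A + constMat c) *ᵥ φ := by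
    intro φ
    rw [Matrix.add_mulVec, dotProduct_add, dotProduct_ellMat_mulVec, constMat_mulVec]
    refine add_nonneg (Finset.sum_nonneg fun x _ => ?_) ?_
    · have h := (hA.2 (fun i => Literature.MathematicalPhysics.StatisticalMechanics.GradientFRD.fwdDiff i φ x)).1
      have e : ∑ i, ∑ j, A i j * Literature.MathematicalPhysics.StatisticalMechanics.GradientFRD.fwdDiff i φ x * Literature.MathematicalPhysics.StatisticalMechanics.GradientFRD.fwdDiff j φ x
          = ∑ i, ∑ j, Literature.MathematicalPhysics.StatisticalMechanics.GradientFRD.fwdDiff i φ x * A i j * Literature.MathematicalPhysics.StatisticalMechanics.GradientFRD.fwdDiff j φ x :=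
        Finset.sum_congr rfl fun i _ => Finset.sum_congr rfl fun j _ => by ring
      rw [e]
      exact le_trans (mul_nonneg hω.le (Finset.sum_nonneg fun i _ => sq_nonneg _)) h
    · simp only [dotProduct, ← Finset.sum_mul]
      have e : (∑ x, φ x) * (c * ∑ x, φ x) = c * (∑ x, φ x) ^ 2 := by ring
      rw [e]; positivity
  have hpsd : (ellMat (M := M) A + constMat c).PosSemidef :=
    Matrix.PosSemidef.of_dotProduct_mulVec_nonneg hsymm fun φ => by rw [star_trivial]; exact hnonneg φ
  refine Matrix.PosDef.of_dotProduct_mulVec_pos hsymm fun φ hφ => ?_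
  rcases (hnonneg φ).lt_or_eq with h | h
  · rw [star_trivial]; exact h
  · exfalso
    have h0 : (ellMat (M := M) A + constMat c) *ᵥ φ = 0 := by
      rw [← hpsd.dotProduct_mulVec_zero_iff φ, star_trivial]; exact h.symm
    have hdet : (ellMat (M := M) A + constMat c).det = 0 :=
      Matrix.exists_mulVec_eq_zero_iff.1 ⟨φ, hφ, h0⟩
    exact (det_ellMat_add_constMat_pos hA hω hc).ne' hdet

/-! ## The mode-sum formula for `log κ_{𝟙,𝟙+q}` -/

/-- **`log κ_{𝟙,𝟙+q} = −½ Σ_{κ≠0} log(1 + symbR q κ/|q(κ)|²)`** for a symmetric `q` with `|z·qz| ≤ s|z|²`,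
`s < 1`. -/
theorem log_formChangeConst_one_add_eq {q : Matrix (Fin d) (Fin d) ℝ} {s : ℝ} (hq : q.IsSymm)
    (hs : ∀ z : Fin d → ℝ, |∑ i, ∑ j, z i * q i j * z j| ≤ s * ∑ i, (z i) ^ 2) (hs1 : s < 1) :
    Real.log (formChangeConst (M := M) (1 : Matrix (Fin d) (Fin d) ℝ) (1 + q))
      = -(1 / 2 : ℝ) * ∑ κ ∈ (Finset.univ : Finset (Fin d → ZMod M)).erase 0,
          Real.log (1 + symbR q κ / qnormSq κ) := by
  have h1 : IsElliptic (1 - 0) (1 + 0) ((1 : Matrix (Fin d) (Fin d) ℝ) + 0) :=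
    isElliptic_one_add_of_form_le (by unfold Matrix.IsSymm; simp) (fun z => by simp)
  simp only [add_zero, sub_zero] at h1
  have h2 : IsElliptic (1 - s) (1 + s) ((1 : Matrix (Fin d) (Fin d) ℝ) + q) := isElliptic_one_add_of_form_le hq hs
  have hω2 : 0 < 1 - s := by linarith
  have hcpos : 0 < (((Fintype.card (Fin d → ZMod M) : ℝ) ^ 2)⁻¹) :=
    inv_pos.2 (pow_pos (by exact_mod_cast Fintype.card_pos) 2)
  rw [log_formChangeConst_eq h1 (by norm_num) h2 hω2 (posDef_ellMat_add_constMat h1 (by norm_num) hcpos)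
    (posDef_ellMat_add_constMat h2 hω2 hcpos), neg_mul, ← mul_neg, ← Finset.sum_neg_distrib]
  congr 1
  refine Finset.sum_congr rfl fun κ hκ => ?_
  have hκ0 : κ ≠ 0 := Finset.ne_of_mem_erase hκ
  have hqn : 0 < qnormSq κ := qnormSq_pos hκ0
  rw [symbR_one, symbR_add, symbR_one]
  have hr : |symbR q κ / qnormSq κ| ≤ s := by
    rw [abs_div, abs_of_pos hqn, div_le_iff₀ hqn]; exact abs_symbR_le_of_form_le hs κ
  have hpos1 : 0 < 1 + symbR q κ / qnormSq κ := by
    have hb := abs_le.1 hr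
    linarith
  have e : qnormSq κ + symbR q κ = qnormSq κ * (1 + symbR q κ / qnormSq κ) := by field_simp
  rw [e, Real.log_mul hqn.ne' hpos1.ne']
  ring

/-! ## Real-variable forms of the `log(1+·)` difference bounds -/

/-- `|log(1+x) − log(1+y)| ≤ |x−y|/(1−R)` for real `|x|, |y| ≤ R < 1`. -/
theorem abs_log_one_add_sub_le {R x y : ℝ} (hR : R < 1) (hx : |x| ≤ R) (hy : |y| ≤ R) :
    |Real.log (1 + x) - Real.log (1 + y)| ≤ 1 / (1 - R) * |x - y| := by
  have hx1 : 0 ≤ 1 + x := by linarith [(abs_le.1 hx).1]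
  have hy1 : 0 ≤ 1 + y := by linarith [(abs_le.1 hy).1]
  have h := norm_log_one_add_sub_le hR (u := (x : ℂ)) (u' := (y : ℂ))
    (by rw [Complex.norm_real, Real.norm_eq_abs]; exact hx) (by rw [Complex.norm_real, Real.norm_eq_abs]; exact hy)
  have e1 : Complex.log (1 + (x : ℂ)) = ((Real.log (1 + x) : ℝ) : ℂ) := by
    rw [Complex.ofReal_log hx1]; push_cast; ring_nf
  have e2 : Complex.log (1 + (y : ℂ)) = ((Real.log (1 + y) : ℝ) : ℂ) := by
    rw [Complex.ofReal_log hy1]; push_cast; ring_nf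
  rw [e1, e2, ← Complex.ofReal_sub, Complex.norm_real, Real.norm_eq_abs, ← Complex.ofReal_sub, Complex.norm_real,
    Real.norm_eq_abs] at h
  exact h

/-- `|log(1+c+a+b) − log(1+c+a) − log(1+c+b) + log(1+c)| ≤ |a||b|/(1−R)²` for a real parallelogram in
`[−R, R]`, `R < 1`. -/
theorem abs_secondDiff_log_one_add_le {R c a b : ℝ} (hR : R < 1) (hc : |c| ≤ R) (hca : |c + a| ≤ R)
    (hcb : |c + b| ≤ R) (hcab : |c + a + b| ≤ R) :
    |Real.log (1 + (c + a + b)) - Real.log (1 + (c + a)) - Real.log (1 + (c + b)) + Real.log (1 + c)|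
      ≤ 1 / (1 - R) ^ 2 * |a| * |b| := by
  have nn : ∀ {t : ℝ}, |t| ≤ R → 0 ≤ 1 + t := fun ht => by linarith [(abs_le.1 ht).1]
  have cast : ∀ {t : ℝ}, |t| ≤ R → ‖(t : ℂ)‖ ≤ R := fun ht => by rw [Complex.norm_real, Real.norm_eq_abs]; exact ht
  have h := norm_secondDiff_log_one_add_le hR (a := (c : ℂ)) (u := (a : ℂ)) (v := (b : ℂ)) (cast hc)
    (by rw [← Complex.ofReal_add]; exact cast hca) (by rw [← Complex.ofReal_add]; exact cast hcb)
    (by rw [← Complex.ofReal_add, ← Complex.ofReal_add]; exact cast hcab)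
  have e : ∀ {t : ℝ}, |t| ≤ R → Complex.log (1 + (t : ℂ)) = ((Real.log (1 + t) : ℝ) : ℂ) := fun ht => by
    rw [Complex.ofReal_log (nn ht)]; push_cast; ring_nf
  simp only [← Complex.ofReal_add] at h
  rw [e hcab, e hca, e hcb, e hc] at h
  simp only [← Complex.ofReal_sub, ← Complex.ofReal_add, Complex.norm_real, Real.norm_eq_abs] at h
  exact h

/-! ## First and second difference bounds of `log κ_{𝟙,𝟙+q}` -/

/-- **Lipschitz bound**: for symmetric `q₁, q₂` with `|z·q_ℓz| ≤ ½|z|²` and `|z·(q₁−q₂)z| ≤ t|z|²`: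
`|log κ_{𝟙,𝟙+q₁} − log κ_{𝟙,𝟙+q₂}| ≤ |Λ|·t` (`|Λ| = M^d`; one unit per non-zero Fourier mode). -/
theorem abs_log_formChangeConst_sub_le {q₁ q₂ : Matrix (Fin d) (Fin d) ℝ} {t : ℝ}
    (hq₁ : q₁.IsSymm) (hq₂ : q₂.IsSymm)
    (hs₁ : ∀ z : Fin d → ℝ, |∑ i, ∑ j, z i * q₁ i j * z j| ≤ (1 / 2 : ℝ) * ∑ i, (z i) ^ 2)
    (hs₂ : ∀ z : Fin d → ℝ, |∑ i, ∑ j, z i * q₂ i j * z j| ≤ (1 / 2 : ℝ) * ∑ i, (z i) ^ 2)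
    (ht0 : 0 ≤ t) (ht : ∀ z : Fin d → ℝ, |∑ i, ∑ j, z i * (q₁ - q₂) i j * z j| ≤ t * ∑ i, (z i) ^ 2) :
    |Real.log (formChangeConst (M := M) (1 : Matrix (Fin d) (Fin d) ℝ) (1 + q₁))
        - Real.log (formChangeConst (M := M) (1 : Matrix (Fin d) (Fin d) ℝ) (1 + q₂))|
      ≤ (Fintype.card (Fin d → ZMod M) : ℝ) * t := by
  rw [log_formChangeConst_one_add_eq hq₁ hs₁ (by norm_num), log_formChangeConst_one_add_eq hq₂ hs₂ (by norm_num),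
    ← mul_sub, ← Finset.sum_sub_distrib, abs_mul]
  have hterm : ∀ κ ∈ (Finset.univ : Finset (Fin d → ZMod M)).erase 0,
      |Real.log (1 + symbR q₁ κ / qnormSq κ) - Real.log (1 + symbR q₂ κ / qnormSq κ)| ≤ 2 * t := by
    intro κ hκ
    have hκ0 : κ ≠ 0 := Finset.ne_of_mem_erase hκ
    have hqn : 0 < qnormSq κ := qnormSq_pos hκ0
    have hr₁ : |symbR q₁ κ / qnormSq κ| ≤ 1 / 2 := by
      rw [abs_div, abs_of_pos hqn, div_le_iff₀ hqn]; exact abs_symbR_le_of_form_le hs₁ κ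
    have hr₂ : |symbR q₂ κ / qnormSq κ| ≤ 1 / 2 := by
      rw [abs_div, abs_of_pos hqn, div_le_iff₀ hqn]; exact abs_symbR_le_of_form_le hs₂ κ
    have h := abs_log_one_add_sub_le (by norm_num : (1 / 2 : ℝ) < 1) hr₁ hr₂
    have hdiff : |symbR q₁ κ / qnormSq κ - symbR q₂ κ / qnormSq κ| ≤ t := by
      rw [← sub_div, ← symbR_sub, abs_div, abs_of_pos hqn, div_le_iff₀ hqn]
      exact abs_symbR_le_of_form_le ht κ
    calc _ ≤ 1 / (1 - 1 / 2) * |symbR q₁ κ / qnormSq κ - symbR q₂ κ / qnormSq κ| := h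
      _ ≤ 1 / (1 - 1 / 2) * t := mul_le_mul_of_nonneg_left hdiff (by norm_num)
      _ = 2 * t := by norm_num
  have hsum := (Finset.abs_sum_le_sum_abs _ _).trans (Finset.sum_le_sum hterm)
  rw [Finset.sum_const, nsmul_eq_mul] at hsum
  have hcard : (((Finset.univ : Finset (Fin d → ZMod M)).erase 0).card : ℝ) ≤ (Fintype.card (Fin d → ZMod M) : ℝ) := by
    exact_mod_cast (Finset.card_erase_le).trans (Finset.card_univ.le)
  calc |(-(1 / 2 : ℝ))| * |∑ κ ∈ (Finset.univ : Finset (Fin d → ZMod M)).erase 0,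
          (Real.log (1 + symbR q₁ κ / qnormSq κ) - Real.log (1 + symbR q₂ κ / qnormSq κ))|
      ≤ (1 / 2 : ℝ) * ((((Finset.univ : Finset (Fin d → ZMod M)).erase 0).card : ℝ) * (2 * t)) := by
        rw [abs_neg, abs_of_pos (by norm_num : (0 : ℝ) < 1 / 2)]
        exact mul_le_mul_of_nonneg_left hsum (by norm_num)
    _ = ((((Finset.univ : Finset (Fin d → ZMod M)).erase 0).card : ℝ)) * t := by ring
    _ ≤ (Fintype.card (Fin d → ZMod M) : ℝ) * t := mul_le_mul_of_nonneg_right hcard ht0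

/-- **Second-difference bound**: over a parallelogram `q, q+a, q+b, q+a+b` of symmetric parameters with
form bound `½`, and directions with `|z·az| ≤ t_a|z|²`, `|z·bz| ≤ t_b|z|²`:
`|log κ(q+a+b) − log κ(q+a) − log κ(q+b) + log κ(q)| ≤ 2|Λ|·t_a·t_b` (`κ(p) = κ_{𝟙,𝟙+p}`). -/
theorem abs_secondDiff_log_formChangeConst_le {q a b : Matrix (Fin d) (Fin d) ℝ} {ta tb : ℝ}
    (hq : q.IsSymm) (ha : a.IsSymm) (hb : b.IsSymm)
    (hs : ∀ z : Fin d → ℝ, |∑ i, ∑ j, z i * q i j * z j| ≤ (1 / 2 : ℝ) * ∑ i, (z i) ^ 2)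
    (hsa : ∀ z : Fin d → ℝ, |∑ i, ∑ j, z i * (q + a) i j * z j| ≤ (1 / 2 : ℝ) * ∑ i, (z i) ^ 2)
    (hsb : ∀ z : Fin d → ℝ, |∑ i, ∑ j, z i * (q + b) i j * z j| ≤ (1 / 2 : ℝ) * ∑ i, (z i) ^ 2)
    (hsab : ∀ z : Fin d → ℝ, |∑ i, ∑ j, z i * (q + a + b) i j * z j| ≤ (1 / 2 : ℝ) * ∑ i, (z i) ^ 2)
    (hta0 : 0 ≤ ta) (hta : ∀ z : Fin d → ℝ, |∑ i, ∑ j, z i * a i j * z j| ≤ ta * ∑ i, (z i) ^ 2)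
    (htb0 : 0 ≤ tb) (htb : ∀ z : Fin d → ℝ, |∑ i, ∑ j, z i * b i j * z j| ≤ tb * ∑ i, (z i) ^ 2) :
    |Real.log (formChangeConst (M := M) (1 : Matrix (Fin d) (Fin d) ℝ) (1 + (q + a + b)))
        - Real.log (formChangeConst (M := M) (1 : Matrix (Fin d) (Fin d) ℝ) (1 + (q + a)))
        - Real.log (formChangeConst (M := M) (1 : Matrix (Fin d) (Fin d) ℝ) (1 + (q + b)))
        + Real.log (formChangeConst (M := M) (1 : Matrix (Fin d) (Fin d) ℝ) (1 + q))|
      ≤ 2 * (Fintype.card (Fin d → ZMod M) : ℝ) * ta * tb := by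
  have hqa : (q + a).IsSymm := by unfold Matrix.IsSymm at *; rw [Matrix.transpose_add, hq, ha]
  have hqb : (q + b).IsSymm := by unfold Matrix.IsSymm at *; rw [Matrix.transpose_add, hq, hb]
  have hqab : (q + a + b).IsSymm := by unfold Matrix.IsSymm at *; rw [Matrix.transpose_add, hqa, hb]
  rw [log_formChangeConst_one_add_eq hqab hsab (by norm_num), log_formChangeConst_one_add_eq hqa hsa (by norm_num),
    log_formChangeConst_one_add_eq hqb hsb (by norm_num), log_formChangeConst_one_add_eq hq hs (by norm_num)]
  have e : ∀ w x y z : ℝ, -(1 / 2 : ℝ) * w - -(1 / 2 : ℝ) * x - -(1 / 2 : ℝ) * y + -(1 / 2 : ℝ) * z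
      = -(1 / 2 : ℝ) * (w - x - y + z) := fun w x y z => by ring
  rw [e, ← Finset.sum_sub_distrib, ← Finset.sum_sub_distrib, ← Finset.sum_add_distrib, abs_mul]
  have hterm : ∀ κ ∈ (Finset.univ : Finset (Fin d → ZMod M)).erase 0,
      |Real.log (1 + symbR (q + a + b) κ / qnormSq κ) - Real.log (1 + symbR (q + a) κ / qnormSq κ)
        - Real.log (1 + symbR (q + b) κ / qnormSq κ) + Real.log (1 + symbR q κ / qnormSq κ)| ≤ 4 * ta * tb := by
    intro κ hκ
    have hκ0 : κ ≠ 0 := Finset.ne_of_mem_erase hκ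
    have hqn : 0 < qnormSq κ := qnormSq_pos hκ0
    have bound : ∀ {p : Matrix (Fin d) (Fin d) ℝ} {s : ℝ},
        (∀ z : Fin d → ℝ, |∑ i, ∑ j, z i * p i j * z j| ≤ s * ∑ i, (z i) ^ 2) → |symbR p κ / qnormSq κ| ≤ s :=
      fun hp => by rw [abs_div, abs_of_pos hqn, div_le_iff₀ hqn]; exact abs_symbR_le_of_form_le hp κ
    have e1 : symbR (q + a) κ / qnormSq κ = symbR q κ / qnormSq κ + symbR a κ / qnormSq κ := by
      rw [symbR_add, add_div]
    have e2 : symbR (q + b) κ / qnormSq κ = symbR q κ / qnormSq κ + symbR b κ / qnormSq κ := by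
      rw [symbR_add, add_div]
    have e3 : symbR (q + a + b) κ / qnormSq κ
        = symbR q κ / qnormSq κ + symbR a κ / qnormSq κ + symbR b κ / qnormSq κ := by
      rw [symbR_add, symbR_add, add_div, add_div]
    have hc := bound hs
    have hca : |symbR q κ / qnormSq κ + symbR a κ / qnormSq κ| ≤ 1 / 2 := by rw [← e1]; exact bound hsa
    have hcb : |symbR q κ / qnormSq κ + symbR b κ / qnormSq κ| ≤ 1 / 2 := by rw [← e2]; exact bound hsb
    have hcab : |symbR q κ / qnormSq κ + symbR a κ / qnormSq κ + symbR b κ / qnormSq κ| ≤ 1 / 2 := by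
      rw [← e3]; exact bound hsab
    have h := abs_secondDiff_log_one_add_le (by norm_num : (1 / 2 : ℝ) < 1) hc hca hcb hcab
    rw [e1, e2, e3]
    refine h.trans ?_
    have h1 : |symbR a κ / qnormSq κ| ≤ ta := bound hta
    have h2 : |symbR b κ / qnormSq κ| ≤ tb := bound htb
    calc 1 / (1 - 1 / 2) ^ 2 * |symbR a κ / qnormSq κ| * |symbR b κ / qnormSq κ|
        = 4 * (|symbR a κ / qnormSq κ| * |symbR b κ / qnormSq κ|) := by norm_num; ring
      _ ≤ 4 * (ta * tb) := mul_le_mul_of_nonneg_left (mul_le_mul h1 h2 (abs_nonneg _) hta0) (by norm_num)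
      _ = 4 * ta * tb := by ring
  have hsum := (Finset.abs_sum_le_sum_abs _ _).trans (Finset.sum_le_sum hterm)
  rw [Finset.sum_const, nsmul_eq_mul] at hsum
  have hcard : (((Finset.univ : Finset (Fin d → ZMod M)).erase 0).card : ℝ) ≤ (Fintype.card (Fin d → ZMod M) : ℝ) := by
    exact_mod_cast (Finset.card_erase_le).trans (Finset.card_univ.le)
  calc |(-(1 / 2 : ℝ))| * |∑ κ ∈ (Finset.univ : Finset (Fin d → ZMod M)).erase 0,
          (Real.log (1 + symbR (q + a + b) κ / qnormSq κ) - Real.log (1 + symbR (q + a) κ / qnormSq κ)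
            - Real.log (1 + symbR (q + b) κ / qnormSq κ) + Real.log (1 + symbR q κ / qnormSq κ))|
      ≤ (1 / 2 : ℝ) * ((((Finset.univ : Finset (Fin d → ZMod M)).erase 0).card : ℝ) * (4 * ta * tb)) := by
        rw [abs_neg, abs_of_pos (by norm_num : (0 : ℝ) < 1 / 2)]
        exact mul_le_mul_of_nonneg_left hsum (by norm_num)
    _ = 2 * ((((Finset.univ : Finset (Fin d → ZMod M)).erase 0).card : ℝ)) * ta * tb := by ring
    _ ≤ 2 * (Fintype.card (Fin d → ZMod M) : ℝ) * ta * tb := by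
        have : 0 ≤ ta * tb := mul_nonneg hta0 htb0
        nlinarith [hcard]

end Summit.HubbardSuperconductivity.HubbardSuperconductivity.Theorems.ComplexGFF

end
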